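import Summits.NavierStokesRegularity.FunctionalMining.RateBudgets
import Summits.NavierStokesRegularity.FunctionalMining.StretchingConst
import Literature.Analysis.FluidPDE.NSGalerkinFourier
import Literature.Analysis.FunctionSpaces.TorusFourierModes
import HarnessLib

/-!
# K1-Q1 lower side in the kernel: the planar family `u_{n,τ}` (part 1: the fields, production, enstrophy)

Cell `pub-nsfunc` (host summit NavierStokesRegularity, topic `FunctionalMining`), prove seat gen 4, on the
bank seat's blueprint `pub-nsfunc-bank/FourModeWitness-BLUEPRINT.md` §7 / `K1Q1-LOWER.md` §1b.
**Search for candidate a priori estimates; no regularity claim.** Static field facts only; nothing is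
asserted about Navier–Stokes.

`C⋆ = stretchingSupConst` is the optimal constant of the static sup-stretching inequality
`∫⟪(v·∇)v, Δv⟫ ≤ C‖ω‖_∞ ℰ(v)` on `T³` (`StretchingSupBound`, K0 row K1-Q1). For `n ≥ 1` and
`0 < τ ≤ 1` the divergence-free trigonometric polynomial
`u_{n,τ}(x) = (−sin(2πn x₂)/n, 0, −sin 2πx₁ − τ cos 2πx₁ sin 2πn x₂)` (eight Fourier modes
`±e₁, ±n e₂, ±(e₁ ± n e₂)`) has production `2π³ n τ` (this file, `production_u`), enstrophy
`π²(4 + (1+n²)τ²)/2` (`torusEnstrophy_u`) and `|ω|² ≤ 4π²(2 + n²τ²)` pointwise (part 2), whence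
`StretchingSupBound C` fails for every `C < r(n,τ) = 2nτ / (√(2+n²τ²)·(4+(1+n²)τ²))` (part 2):
`r(1,1) = √3/9 ≈ 0.192`, and `r(n, λ⋆/n) ↑ √(71 − 17√17)/4 ≈ 0.2381` (`λ⋆² = (√17−1)/2`), the bank's
best hand bound, so `√(71 − 17√17)/4 ≤ C⋆ ≤ 2/√3` in the kernel.

This part: the wavevectors `V n a b = (a, b n, 0)` and their bookkeeping (symbolic `n`), the coefficient
table, reality / transversality, the production as a Fourier sum and its value, the enstrophy by Parseval.
-/

noncomputable section

open MeasureTheory Complex Finset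
open scoped RealInnerProductSpace ComplexConjugate

namespace Summit.NavierStokesRegularity.FunctionalMining

open Literature.Analysis Literature.Analysis.FunctionSpaces Literature.Analysis.FunctionSpaces.Torus
open Literature.Analysis.FluidPDE UnitAddTorus

namespace StretchFamily

variable {n : ℕ} {τ : ℝ}

/-! ## 1. Wavevectors `(a, b·n, 0)` with symbolic `n` -/

/-- The wavevector `V n a b = (a, b·n, 0) ∈ ℤ³`. [ours; bookkeeping] -/
def V (n : ℕ) (a b : ℤ) : Fin 3 → ℤ := ![a, b * n, 0]

/-- First coordinate of `V n a b`. [ours; bookkeeping] -/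
@[simp] theorem V_apply_zero (n : ℕ) (a b : ℤ) : V n a b 0 = a := rfl
/-- Second coordinate of `V n a b`. [ours; bookkeeping] -/
@[simp] theorem V_apply_one (n : ℕ) (a b : ℤ) : V n a b 1 = b * n := rfl
/-- Third coordinate of `V n a b`. [ours; bookkeeping] -/
@[simp] theorem V_apply_two (n : ℕ) (a b : ℤ) : V n a b 2 = 0 := rfl

/-- `V` is additive in `(a, b)`. [ours; bookkeeping] -/
theorem V_add (n : ℕ) (a b a' b' : ℤ) : V n a b + V n a' b' = V n (a + a') (b + b') := by
  ext i; fin_cases i <;> simp [V, add_mul]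

/-- `−V n a b = V n (−a) (−b)`. [ours; bookkeeping] -/
theorem V_neg (n : ℕ) (a b : ℤ) : -V n a b = V n (-a) (-b) := by
  ext i; fin_cases i <;> simp [V]

/-- `V n 0 0 = 0`. [ours; bookkeeping] -/
theorem V_zero (n : ℕ) : V n 0 0 = 0 := by
  ext i; fin_cases i <;> simp [V]

/-- For `n ≠ 0`, `V n a b = V n a' b' ↔ a = a' ∧ b = b'` — the one fact that replaces `decide` for
symbolic `n`. [ours; bookkeeping] -/
theorem V_inj (hn : n ≠ 0) {a b a' b' : ℤ} : V n a b = V n a' b' ↔ a = a' ∧ b = b' := by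
  constructor
  · intro h
    have h0 := congrFun h 0
    have h1 := congrFun h 1
    simp only [V_apply_zero, V_apply_one] at h0 h1
    exact ⟨h0, mul_right_cancel₀ (by exact_mod_cast hn) h1⟩
  · rintro ⟨rfl, rfl⟩; rfl

/-! ## 2. Support and coefficients of `u_{n,τ}` -/

/-- The Fourier support `S n = {±e₁, ±n e₂, ±(e₁ + n e₂), ±(e₁ − n e₂)}`. [ours] -/
def S (n : ℕ) : Finset (Fin 3 → ℤ) :=
  {V n 1 0, V n (-1) 0, V n 0 1, V n 0 (-1), V n 1 1, V n (-1) (-1), V n 1 (-1), V n (-1) 1}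

/-- The coefficients: `ĉ(±e₁) = (0,0,±i/2)`, `ĉ(±n e₂) = (±i/(2n),0,0)`, `ĉ(±(e₁+n e₂)) = (0,0,±iτ/4)`,
`ĉ(±(e₁−n e₂)) = (0,0,∓iτ/4)`, zero elsewhere. [ours] -/
def c (n : ℕ) (τ : ℝ) (k : Fin 3 → ℤ) : EuclideanSpace ℂ (Fin 3) :=
  if k = V n 1 0 then !₂[0, 0, I / 2]
  else if k = V n (-1) 0 then !₂[0, 0, -(I / 2)]
  else if k = V n 0 1 then !₂[I / (2 * n), 0, 0]
  else if k = V n 0 (-1) then !₂[-(I / (2 * n)), 0, 0]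
  else if k = V n 1 1 then !₂[0, 0, I * τ / 4]
  else if k = V n (-1) (-1) then !₂[0, 0, -(I * τ / 4)]
  else if k = V n 1 (-1) then !₂[0, 0, -(I * τ / 4)]
  else if k = V n (-1) 1 then !₂[0, 0, I * τ / 4]
  else 0

/-- **The field** `u_{n,τ} = Re ∑_{k ∈ S n} e_k ĉ(k) = (−sin(2πn x₂)/n, 0, −sin 2πx₁ − τ cos 2πx₁ sin 2πn x₂)`.
[ours] -/
def u (n : ℕ) (τ : ℝ) : UnitAddTorus (Fin 3) → EuclideanSpace ℝ (Fin 3) := realTrigPoly (S n) (c n τ)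

/-- Membership in `S n`, spelled out. [ours; bookkeeping] -/
theorem mem_S {k : Fin 3 → ℤ} : k ∈ S n ↔ k = V n 1 0 ∨ k = V n (-1) 0 ∨ k = V n 0 1 ∨ k = V n 0 (-1) ∨
    k = V n 1 1 ∨ k = V n (-1) (-1) ∨ k = V n 1 (-1) ∨ k = V n (-1) 1 := by
  simp only [S, Finset.mem_insert, Finset.mem_singleton]

/-- `S n` is symmetric under `k ↦ −k`. [ours; bookkeeping] -/
theorem neg_mem_S (hn : n ≠ 0) : ∀ k ∈ S n, -k ∈ S n := by
  intro k hk
  rcases mem_S.mp hk with rfl | rfl | rfl | rfl | rfl | rfl | rfl | rfl <;>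
    simp [mem_S, V_neg, V_inj hn]

/-- `0 ∉ S n`. [ours; bookkeeping] -/
theorem zero_not_mem_S (hn : n ≠ 0) : (0 : Fin 3 → ℤ) ∉ S n := by
  rw [← V_zero n]; simp [mem_S, V_inj hn]

/-- Sums over `S n`, unrolled (the eight wavevectors are distinct for `n ≠ 0`). [ours; bookkeeping] -/
theorem sum_S (hn : n ≠ 0) {M : Type*} [AddCommMonoid M] (f : (Fin 3 → ℤ) → M) :
    ∑ k ∈ S n, f k = f (V n 1 0) + f (V n (-1) 0) + f (V n 0 1) + f (V n 0 (-1)) +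
      f (V n 1 1) + f (V n (-1) (-1)) + f (V n 1 (-1)) + f (V n (-1) 1) := by
  simp only [S]
  rw [Finset.sum_insert, Finset.sum_insert, Finset.sum_insert, Finset.sum_insert,
    Finset.sum_insert, Finset.sum_insert, Finset.sum_insert, Finset.sum_singleton]
  · simp only [add_assoc]
  all_goals simp [V_inj hn]

/-! ### The coefficient table -/

/-- `ĉ(e₁) = (0,0,i/2)`. [ours; bookkeeping] -/
theorem c_p0 : c n τ (V n 1 0) = !₂[0, 0, I / 2] := by rw [c, if_pos rfl]
/-- `ĉ(−e₁) = (0,0,−i/2)`. [ours; bookkeeping] -/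
theorem c_m0 (hn : n ≠ 0) : c n τ (V n (-1) 0) = !₂[0, 0, -(I / 2)] := by
  simp [c, V_inj hn]
/-- `ĉ(n e₂) = (i/(2n),0,0)`. [ours; bookkeeping] -/
theorem c_0p (hn : n ≠ 0) : c n τ (V n 0 1) = !₂[I / (2 * n), 0, 0] := by
  simp [c, V_inj hn]
/-- `ĉ(−n e₂) = (−i/(2n),0,0)`. [ours; bookkeeping] -/
theorem c_0m (hn : n ≠ 0) : c n τ (V n 0 (-1)) = !₂[-(I / (2 * n)), 0, 0] := by
  simp [c, V_inj hn]
/-- `ĉ(e₁ + n e₂) = (0,0,iτ/4)`. [ours; bookkeeping] -/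
theorem c_pp (hn : n ≠ 0) : c n τ (V n 1 1) = !₂[0, 0, I * τ / 4] := by
  simp [c, V_inj hn]
/-- `ĉ(−e₁ − n e₂) = (0,0,−iτ/4)`. [ours; bookkeeping] -/
theorem c_mm (hn : n ≠ 0) : c n τ (V n (-1) (-1)) = !₂[0, 0, -(I * τ / 4)] := by
  simp [c, V_inj hn]
/-- `ĉ(e₁ − n e₂) = (0,0,−iτ/4)`. [ours; bookkeeping] -/
theorem c_pm (hn : n ≠ 0) : c n τ (V n 1 (-1)) = !₂[0, 0, -(I * τ / 4)] := by
  simp [c, V_inj hn]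
/-- `ĉ(−e₁ + n e₂) = (0,0,iτ/4)`. [ours; bookkeeping] -/
theorem c_mp (hn : n ≠ 0) : c n τ (V n (-1) 1) = !₂[0, 0, I * τ / 4] := by
  simp [c, V_inj hn]

/-- Off the support the coefficients vanish. [ours; bookkeeping] -/
theorem c_of_not_mem {k : Fin 3 → ℤ} (hk : k ∉ S n) : c n τ k = 0 := by
  simp only [mem_S, not_or] at hk
  obtain ⟨h1, h2, h3, h4, h5, h6, h7, h8⟩ := hk
  rw [c, if_neg h1, if_neg h2, if_neg h3, if_neg h4, if_neg h5, if_neg h6, if_neg h7, if_neg h8]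

/-- **Reality**: `ĉ(−k) = conj ĉ(k)`. [ours] -/
theorem isConjSymm_c (hn : n ≠ 0) : IsConjSymm (c n τ) := by
  intro k
  by_cases hk : k ∈ S n
  · rcases mem_S.mp hk with rfl | rfl | rfl | rfl | rfl | rfl | rfl | rfl <;>
      simp only [V_neg, neg_neg, Int.reduceNeg, neg_zero, c_p0, c_m0 hn, c_0p hn, c_0m hn, c_pp hn,
        c_mm hn, c_pm hn, c_mp hn] <;>
      ext i <;> fin_cases i <;> simp [EuclideanSpace.conjVec_apply, map_ofNat, neg_div]
  · have hnk : -k ∉ S n := fun h => hk (by simpa using neg_mem_S hn (-k) h)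
    rw [c_of_not_mem hk, c_of_not_mem hnk, EuclideanSpace.conjVec_zero]

/-- **Transversality** `k · ĉ(k) = 0` on `S n`: the field is divergence free. [ours] -/
theorem isTransversal_c (hn : n ≠ 0) : IsTransversal (S n) (c n τ) := by
  intro k hk
  rcases mem_S.mp hk with rfl | rfl | rfl | rfl | rfl | rfl | rfl | rfl <;>
    simp [c_p0, c_m0 hn, c_0p hn, c_0m hn, c_pp hn, c_mm hn, c_pm hn, c_mp hn, Fin.sum_univ_three]

/-- `u_{n,τ}` is smooth. [ours] -/
theorem isSmooth_u : IsSmooth (u n τ) := isSmooth_realTrigPoly (S n) (c n τ)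

/-- `u_{n,τ}` is divergence free. [ours] -/
theorem isDivFree_u (hn : n ≠ 0) : IsDivFree (u n τ) := isDivFree_realTrigPoly (isTransversal_c hn)

/-! ## 3. The production `∫⟪(u·∇)u, Δu⟫ = 2π³ n τ` -/

/-- Laplacian coefficients `−4π²|k|² ĉ(k)`. [ours; bookkeeping] -/
def cΔ (n : ℕ) (τ : ℝ) (k : Fin 3 → ℤ) : EuclideanSpace ℂ (Fin 3) :=
  -(((4 * Real.pi ^ 2 * freqNormSq k : ℝ) : ℂ) • c n τ k)

/-- `Δu = Re ∑ e_k (−4π²|k|² ĉ(k))`. [folklore] -/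
theorem laplacian_u (x : UnitAddTorus (Fin 3)) :
    Torus.laplacian (u n τ) x = realTrigPoly (S n) (cΔ n τ) x :=
  laplacian_realTrigPoly (S n) (c n τ) x

/-- The Laplacian coefficients are conjugate-symmetric. [folklore] -/
theorem isConjSymm_cΔ (hn : n ≠ 0) : IsConjSymm (cΔ n τ) := by
  intro k
  simp only [cΔ]
  rw [isConjSymm_c hn k, freqNormSq_neg, EuclideanSpace.conjVec_neg, EuclideanSpace.conjVec_smul,
    Complex.conj_ofReal]

/-- **The production as a finite Fourier sum** `∫⟪(u·∇)u, Δu⟫ = ∑_{k∈S} Re⟪N̂(k), −4π²|k|² ĉ(k)⟫_ℂ`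
(Parseval against `Δu`; `N̂ = convectionCoeff`). [folklore] -/
theorem production_eq_sum (hn : n ≠ 0) :
    ∫ x, inner ℝ (Torus.convect (u n τ) (u n τ) x) (Torus.laplacian (u n τ) x) =
      ∑ k ∈ S n, (inner ℂ (Torus.convectionCoeff (S n) (c n τ) (c n τ) k) (cΔ n τ k)).re := by
  simp_rw [laplacian_u]
  rw [integral_inner_realTrigPoly_right (neg_mem_S hn) (isConjSymm_cΔ hn)
    ((isSmooth_u.convect isSmooth_u).memLp 2)]
  refine Finset.sum_congr rfl fun k _ => ?_
  rw [show u n τ = realTrigPoly (S n) (c n τ) from rfl,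
    Torus.mFourierCoeff_convect_realTrigPoly (neg_mem_S hn) (isConjSymm_c hn) (isConjSymm_c hn) k]

/-- `i³ = −i`. [folklore] -/
private theorem I_pow_three' : I ^ 3 = -I := by
  rw [pow_succ, Complex.I_sq]; ring

/-- `|V n a b|² = a² + b² n²`. [ours; bookkeeping] -/
theorem freqNormSq_V (n : ℕ) (a b : ℤ) : freqNormSq (V n a b) = (a : ℝ) ^ 2 + (b : ℝ) ^ 2 * (n : ℝ) ^ 2 := by
  simp [freqNormSq, V, Fin.sum_univ_three]
  ring

/-- The convection coefficients `N̂(k)`, `k ∈ S n`: `N̂(±e₁) = (0,0,±iπτ/(2n))`,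
`N̂(±(e₁+ne₂)) = (0,0,∓iπ/(2n))`, `N̂(±(e₁−ne₂)) = (0,0,±iπ/(2n))`, `N̂(±ne₂) = 0`
(`(u·∇)u = (0, 0, u₁∂₁u₃)`). [ours; elementary] -/
theorem convectionCoeff_table (hn : n ≠ 0) :
    Torus.convectionCoeff (S n) (c n τ) (c n τ) (V n 1 0) = !₂[0, 0, I * (Real.pi * τ / (2 * n) : ℝ)] ∧
    Torus.convectionCoeff (S n) (c n τ) (c n τ) (V n (-1) 0) = !₂[0, 0, -(I * (Real.pi * τ / (2 * n) : ℝ))] ∧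
    Torus.convectionCoeff (S n) (c n τ) (c n τ) (V n 0 1) = 0 ∧
    Torus.convectionCoeff (S n) (c n τ) (c n τ) (V n 0 (-1)) = 0 ∧
    Torus.convectionCoeff (S n) (c n τ) (c n τ) (V n 1 1) = !₂[0, 0, -(I * (Real.pi / (2 * n) : ℝ))] ∧
    Torus.convectionCoeff (S n) (c n τ) (c n τ) (V n (-1) (-1)) = !₂[0, 0, I * (Real.pi / (2 * n) : ℝ)] ∧
    Torus.convectionCoeff (S n) (c n τ) (c n τ) (V n 1 (-1)) = !₂[0, 0, I * (Real.pi / (2 * n) : ℝ)] ∧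
    Torus.convectionCoeff (S n) (c n τ) (c n τ) (V n (-1) 1) = !₂[0, 0, -(I * (Real.pi / (2 * n) : ℝ))] := by
  have hn' : (n : ℂ) ≠ 0 := by exact_mod_cast hn
  refine ⟨?_, ?_, ?_, ?_, ?_, ?_, ?_, ?_⟩
  all_goals
    rw [Torus.convectionCoeff, sum_S hn]
    simp only [sum_S hn, c_p0, c_m0 hn, c_0p hn, c_0m hn, c_pp hn, c_mm hn, c_pm hn, c_mp hn, V_add,
      V_inj hn]
    norm_num
    ext i; fin_cases i <;> simp [Fin.sum_univ_three] <;> ring_nf <;> simp only [I_pow_three'] <;> ring_nf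

/-- **The production of `u_{n,τ}` is `2π³ n τ`.** [ours; elementary] -/
theorem production_u (hn : n ≠ 0) :
    ∫ x, inner ℝ (Torus.convect (u n τ) (u n τ) x) (Torus.laplacian (u n τ) x) =
      2 * Real.pi ^ 3 * n * τ := by
  have hn' : (n : ℝ) ≠ 0 := by exact_mod_cast hn
  obtain ⟨h1, h2, h3, h4, h5, h6, h7, h8⟩ := convectionCoeff_table (τ := τ) hn
  rw [production_eq_sum hn, sum_S hn, h1, h2, h3, h4, h5, h6, h7, h8]
  simp only [cΔ, c_p0, c_m0 hn, c_0p hn, c_0m hn, c_pp hn, c_mm hn, c_pm hn, c_mp hn, freqNormSq_V]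
  simp [PiLp.inner_apply, Fin.sum_univ_three, Complex.mul_re, Complex.mul_im, -Complex.ofReal_pow,
    Complex.div_re, Complex.div_im]
  field_simp
  ring

/-- `enstrophyProduction u_{n,τ} = 2π³ n τ`. [ours] -/
theorem enstrophyProduction_u (hn : n ≠ 0) : enstrophyProduction (u n τ) = 2 * Real.pi ^ 3 * n * τ :=
  production_u hn

/-! ## 4. The enstrophy `ℰ(u_{n,τ}) = π²(4 + (1+n²)τ²)/2` -/

/-- `‖∇u‖² = 4π² ∑_k |k|²‖ĉ(k)‖² = 4π² + π²(1+n²)τ²`. [ours; elementary] -/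
theorem gradNormSq_u (hn : n ≠ 0) :
    Torus.gradNormSq (u n τ) = 4 * Real.pi ^ 2 + Real.pi ^ 2 * (1 + (n : ℝ) ^ 2) * τ ^ 2 := by
  have hn' : (n : ℝ) ≠ 0 := by exact_mod_cast hn
  rw [show u n τ = realTrigPoly (S n) (c n τ) from rfl,
    gradNormSq_eq_toReal_eGradNormSq_holds (isSmooth_realTrigPoly (S n) (c n τ)),
    toReal_eGradNormSq_realTrigPoly (neg_mem_S hn) (isConjSymm_c hn), sum_S hn]
  simp only [c_p0, c_m0 hn, c_0p hn, c_0m hn, c_pp hn, c_mm hn, c_pm hn, c_mp hn, freqNormSq_V]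
  simp [EuclideanSpace.norm_eq, Fin.sum_univ_three, Complex.norm_real, div_pow, sq_abs,
    Real.sqrt_sq_eq_abs]
  field_simp
  ring

/-- **`ℰ(u_{n,τ}) = π²(4 + (1+n²)τ²)/2`.** [ours; elementary] -/
theorem torusEnstrophy_u (hn : n ≠ 0) :
    torusEnstrophy (u n τ) = Real.pi ^ 2 * (4 + (1 + (n : ℝ) ^ 2) * τ ^ 2) / 2 := by
  rw [torusEnstrophy, gradNormSq_u hn]; ring

end StretchFamily

end Summit.NavierStokesRegularity.FunctionalMining

end
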